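import Literature.NumberTheory.LFunctions.Zhang2022.RepairTprintWitness
import Literature.NumberTheory.LFunctions.Zhang2022.RepairResidualBoxes

/-!
# Zhang (2022) §18-margin repair rung F-S1R, ANNEX [Q2-9]: the UNREDUCED printed §18 display holds at
# the admissible corner `W` — kernel certificates `Margin232D W`, `Margin232P W` (stated `e″`) and their
# derived-`e″` twins

Trunk T-ANT (NumberTheory/LFunctions). Y. Zhang, *Discrete mean estimates and the Landau–Siegel
zero*, arXiv:2211.02515v1 (2022) [Zhang2022LandauSiegel] — **an unrefereed manuscript under
adjudication; nothing here asserts or denies its Theorems 1–2 or any analytic lemma; no claim about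
Landau–Siegel zeros is made.** Rung F-S1R (D-0077), seat repair-p4; companion of `RepairTprintWitness`
(REPAIR-LEDGER row 9, REPAIR-STATE §1/§2 T-print annex).

`RepairTprintWitness` certifies the REDUCED transcribed total at `W` (`C232D W, C232P W < 0.001`). The
object of record G-C1 is the printed display itself, `Skeleton.Margin232` := `𝔠₁ + 𝔠₂ + 2(Re 𝔠₃ + 10⁻⁵) <
0.001` with the UNREDUCED `𝔠₃` of (18.1) [§18 p. 99], continued to the class by p1 as ONE functional of `θ`:
`Repair.Margin232P θ` (printed `c₃₄`-prefactor; `Margin232P θ₀ ↔ Skeleton.Margin232`,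
`RepairFrakc12Theta`) and `Repair.Margin232D θ` (derived prefactor, reading of record). With the residual
boxes of `RepairResidualBoxes` (`R3TB/R4TB`) at the point windows of `W` (`cut₁ = ½`, `ν₁ − cut₁ = 1/20000`,
`L₆ = 1/40000`, `L₇ = 1/20000`) this file certifies:

* `margin232D_thetaW : Margin232D thetaW`, `margin232P_thetaW : Margin232P thetaW` — **the printed §18
  margin inequality, as one functional of the design, HOLDS at an admissible design** (stated `e″`;
  kernel balls `≈ 0.0005493 / 0.0004387 < 0.001`);
* `margin232_derived_thetaW(_P)` — the same with the DERIVED `e″` of (B.3) (`frakc3DT`, reading of record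
  R2), via the exact boundary form `identResidualDT_eq_boundary` (box `wRDD`);
* `margin232_met_in_class : ∃ θ, AdmissibleTheta θ ∧ Margin232D θ ∧ Margin232P θ ∧ 3000 < C233T θ ∧ ¬T-true`
  and `not_forall_not_margin232P : ¬ ∀ θ, AdmissibleTheta θ → ¬ Margin232P θ`: the failing inequality of
  record (refuted at the printed `θ₀` by `Skeleton.not_margin232`, and for every `ι` by
  `no_iota_meets_ceiling`) is NOT refutable over the whole class — it is rescued at the corner `W`, where
  however `C₂₃₃ > 3000` and the joint criterion fails (`RepairTprintWitness.not_trueNeed_thetaW`).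

One `decide +kernel` (`wMargCert_holds`); no analytic content, no new `Prop` facts, nothing about
Theorems 1–2. Numeric twin (lineage C engine at this `ι`): `0.000549309 / 0.000438754`, inside the kernel
balls.

## References

* Y. Zhang, arXiv:2211.02515v1 (2022), §2 (2.32)–(2.33) p. 11, §12 (12.10), (12.13), (12.15), Lemma 15.1,
  §18 (18.1)–(18.2) p. 99, Appendix B (B.3). [cite: Zhang2022LandauSiegel, §§2, 12, 15, 18, App. B]
* R. E. Moore, *Interval Analysis*, Prentice-Hall (1966), Theorem 3.1. [Moore1966]
-/

noncomputable section

open Complex Real ComplexConjugate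
open Literature.Analysis.ValidatedNumerics.Numerics

namespace Literature.NumberTheory.LFunctions.Zhang2022

namespace Repair

attribute [local irreducible] CB.add CB.sub CB.mul CB.neg CB.conj CB.mulFI CB.mulI CB.mulInt
  CB.ofFI CB.ofInt CB.normSqFI CB.expI FI.add FI.sub FI.mul FI.neg FI.mulInt FI.divNat FI.divPos
  FI.ofRat FI.ofInt FI.pi qCB piMul expIpi overPiFI piISq mulPiFI scaleRatFI recipFI
  recipMulPiFI expIpiFI

/-! ### The windows of `W` and the residual boxes at `W` -/

/-- point intervals of `cut₁(W) = 1/2`, `ν₁ − cut₁ = 1/20000`, `L₆ = ν₁ + ν₃ − 1 = 1/40000`,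
`L₇ = ν₁ + ν₂ − 1 = 1/20000`. [cite: Zhang2022LandauSiegel, §12 (12.1), (12.13)] -/
def wVc : FI := FI.ofRat (1 / 2)
/-- [cite: Zhang2022LandauSiegel, §12 (12.10)] -/
def wW : FI := FI.ofRat (1 / 20000)
/-- [cite: Zhang2022LandauSiegel, §12 (12.13)] -/
def wL6 : FI := FI.ofRat (1 / 40000)
/-- [cite: Zhang2022LandauSiegel, §12 (12.13)] -/
def wL7 : FI := FI.ofRat (1 / 20000)

/-- the windows of `W` as casts of rationals. [cite: Zhang2022LandauSiegel, §12 (12.1), (12.10), (12.13)] -/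
theorem thetaW_windows :
    thetaW.cut1 = ((1 / 2 : ℚ) : ℝ) ∧ thetaW.win = ((1 / 20000 : ℚ) : ℝ) ∧
    thetaW.L6 = ((1 / 40000 : ℚ) : ℝ) ∧ thetaW.L7 = ((1 / 20000 : ℚ) : ℝ) := by
  refine ⟨?_, ?_, ?_, ?_⟩ <;> norm_num [thetaW, Theta.win, Theta.L6, Theta.L7]

/-- residual boxes at `W`. [cite: Zhang2022LandauSiegel, §18 before (18.2)] -/
def wR3 : CB := R3TB (13/10) (13/10) wV1 wV3 wVc wW wL6
/-- [cite: Zhang2022LandauSiegel, §18 before (18.2)] -/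
def wR4 : CB := R4TB (13/10) (27/10) wV1 wV2 wVc wW wL7

/-- residual flag at `W`. [folklore] -/
def wResidOK : Bool := residOK (13/10) (27/10) (13/10) wV1 wV2 wV3 wVc wW wL6 wL7

/-- `R₃(W) ∈ wR3`, `R₄(W) ∈ wR4` (given the flag). [cite: Moore1966, Theorem 3.1] -/
theorem mem_wR (hok : wResidOK = true) : CB.mem (R3T thetaW) wR3 ∧ CB.mem (R4T thetaW) wR4 := by
  obtain ⟨n1, n2, n3, k1, k2, k3⟩ := thetaW_casts
  obtain ⟨wc, ww, w6, w7⟩ := thetaW_windows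
  have h1 : FI.mem thetaW.nu1 wV1 := by rw [n1]; exact FI.mem_ofRat _
  have h2 : FI.mem thetaW.nu2 wV2 := by rw [n2]; exact FI.mem_ofRat _
  have h3 : FI.mem thetaW.nu3 wV3 := by rw [n3]; exact FI.mem_ofRat _
  have hc : FI.mem thetaW.cut1 wVc := by rw [wc]; exact FI.mem_ofRat _
  have hw : FI.mem thetaW.win wW := by rw [ww]; exact FI.mem_ofRat _
  have h6 : FI.mem thetaW.L6 wL6 := by rw [w6]; exact FI.mem_ofRat _
  have h7 : FI.mem thetaW.L7 wL7 := by rw [w7]; exact FI.mem_ofRat _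
  have hn1 : thetaW.nu1 ≠ 0 := by norm_num [thetaW]
  have hn2 : thetaW.nu2 ≠ 0 := by norm_num [thetaW]
  have hn3 : thetaW.nu3 ≠ 0 := by norm_num [thetaW]
  unfold wResidOK at hok
  exact ⟨mem_R3TB k1 k3 (by norm_num) (by norm_num) hn1 hn3 h1 h3 hc hw h6 hok,
    mem_R4TB k1 k2 (by norm_num) (by norm_num) hn1 hn2 h1 h2 hc hw h7 hok⟩

/-! ### The printed margin display at `W` -/

/-- **the stated-`e″` margin LHS at `W`**: `margin232LHS W c₁ c₂ = C232T W c₁ c₂ + 2(Re R₄(W) − Re R₃(W)) + 2·10⁻⁵`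
(`ι₃ = −1`, `ι₄ = 1`). [cite: Zhang2022LandauSiegel, §18 p. 99] -/
theorem margin232LHS_thetaW (c1 c2 : ℂ) :
    margin232LHS thetaW c1 c2 = C232T thetaW c1 c2 + 2 * ((R4T thetaW).re - (R3T thetaW).re) + 2e-5 := by
  rw [margin232LHS_eq, identResidualT_eq]
  have i3 : thetaW.iota3 = -1 := rfl
  have i4 : thetaW.iota4 = 1 := rfl
  rw [i3, i4]
  simp only [map_neg, map_one, neg_mul, one_mul, Complex.add_re, Complex.neg_re]
  ring

/-- box of the stated-`e″` margin LHS at `W`, derived prefactor. [cite: Zhang2022LandauSiegel, §18 p. 99] -/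
def wMargD : FI := (wTotD.add ((wR4.re.sub wR3.re).mulInt 2)).add (FI.ofRat (1 / 50000))
/-- … printed prefactor. [cite: Zhang2022LandauSiegel, §18 p. 99] -/
def wMargP : FI := (wTotP.add ((wR4.re.sub wR3.re).mulInt 2)).add (FI.ofRat (1 / 50000))

/-- inclusion for the margin boxes. [cite: Moore1966, Theorem 3.1] -/
theorem mem_wMarg_of {x : ℝ} {X : FI} (hx : FI.mem x X) (hok : wResidOK = true) :
    FI.mem (x + 2 * ((R4T thetaW).re - (R3T thetaW).re) + 2e-5)
      ((X.add ((wR4.re.sub wR3.re).mulInt 2)).add (FI.ofRat (1 / 50000))) := by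
  have hR := mem_wR hok
  have h := FI.mem_add (FI.mem_add hx (FI.mem_mulInt (FI.mem_sub hR.2.1 hR.1.1) 2))
    (FI.mem_ofRat (1 / 50000))
  convert h using 1
  push_cast
  ring

/-! ### The DERIVED-`e″` residual at `W` (exact boundary form `identResidualDT_eq_boundary`) -/

/-- box of the `j`-th bracket `(e₂ⱼ − A₂ⱼ) − (e₃ⱼ − A₃ⱼ)` at `W` (`ῑ₄ = 1`, `ῑ₃ = −1`).
[cite: Zhang2022LandauSiegel, §18 before (18.2)] -/
def wDj (j : ℕ) : CB :=
  ((eRB (27/10) j wV2).sub (ATB (27/10) j wV2 wL7)).sub ((eRB (13/10) j wV3).sub (ATB (13/10) j wV3 wL6))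

/-- box of the derived-`e″` residual `identResidualᴰ(W) = π b*(W) Σ_j (3,6,3)_j ((e₂ⱼ − A₂ⱼ) − (e₃ⱼ − A₃ⱼ))(W)`.
[cite: Zhang2022LandauSiegel, §18 before (18.2), Appendix B (B.3)] -/
def wRDD : CB :=
  ((bstarTB (13/10) wV1 wW).mulFI FI.pi).mul
    ((((wDj 1).mulInt 3).add ((wDj 2).mulInt 6)).add ((wDj 3).mulInt 3))

/-- `identResidualᴰ(W) ∈ wRDD` (given the flag). [cite: Moore1966, Theorem 3.1] -/
theorem mem_wRDD (hok : wResidOK = true) : CB.mem (identResidualDT thetaW) wRDD := by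
  obtain ⟨n1, n2, n3, k1, k2, k3⟩ := thetaW_casts
  obtain ⟨-, ww, w6, w7⟩ := thetaW_windows
  have h1 : FI.mem thetaW.nu1 wV1 := by rw [n1]; exact FI.mem_ofRat _
  have h2 : FI.mem thetaW.nu2 wV2 := by rw [n2]; exact FI.mem_ofRat _
  have h3 : FI.mem thetaW.nu3 wV3 := by rw [n3]; exact FI.mem_ofRat _
  have hw : FI.mem thetaW.win wW := by rw [ww]; exact FI.mem_ofRat _
  have h6 : FI.mem thetaW.L6 wL6 := by rw [w6]; exact FI.mem_ofRat _
  have h7 : FI.mem thetaW.L7 wL7 := by rw [w7]; exact FI.mem_ofRat _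
  have hn2 : thetaW.nu2 ≠ 0 := by norm_num [thetaW]
  have hn3 : thetaW.nu3 ≠ 0 := by norm_num [thetaW]
  unfold wResidOK at hok
  simp only [residOK, Bool.and_eq_true] at hok
  obtain ⟨⟨⟨⟨⟨-, hb⟩, he3⟩, he2⟩, hA3⟩, hA2⟩ := hok
  have hB := mem_bstarTB k1 (by norm_num) h1 hw hb
  have hE3 : ∀ j, CB.mem (e3T thetaW j) (eRB (13/10) j wV3) := fun j => by
    unfold e3T; rw [k3]; exact mem_eRB h3 hn3 (by norm_num) he3 j
  have hE2 : ∀ j, CB.mem (e2T thetaW j) (eRB (27/10) j wV2) := fun j => by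
    unfold e2T; rw [k2]; exact mem_eRB h2 hn2 (by norm_num) he2 j
  have hA3' := fun j => mem_A3TB k3 (by norm_num) h3 h6 hA3 j
  have hA2' := fun j => mem_A2TB k2 (by norm_num) h2 h7 hA2 j
  have hD : ∀ j, CB.mem ((e2T thetaW j - A2T thetaW j) - (e3T thetaW j - A3T thetaW j)) (wDj j) := fun j => by
    unfold wDj; exact CB.mem_sub (CB.mem_sub (hE2 j) (hA2' j)) (CB.mem_sub (hE3 j) (hA3' j))
  have hθk : thetaW.k1 ≠ 0 := by norm_num [thetaW]
  have i3 : thetaW.iota3 = -1 := rfl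
  have i4 : thetaW.iota4 = 1 := rfl
  have e : identResidualDT thetaW = bstarT thetaW * ((π : ℝ) : ℂ) *
      (((e2T thetaW 1 - A2T thetaW 1) - (e3T thetaW 1 - A3T thetaW 1)) * ((3 : ℤ) : ℂ)
        + ((e2T thetaW 2 - A2T thetaW 2) - (e3T thetaW 2 - A3T thetaW 2)) * ((6 : ℤ) : ℂ)
        + ((e2T thetaW 3 - A2T thetaW 3) - (e3T thetaW 3 - A3T thetaW 3)) * ((3 : ℤ) : ℂ)) := by
    rw [identResidualDT_eq_boundary thetaW hθk, i3, i4]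
    simp only [map_neg, map_one]
    push_cast
    ring
  rw [e]
  unfold wRDD
  exact CB.mem_mul (CB.mem_mulFI hB FI.mem_pi) (CB.mem_add (CB.mem_add (CB.mem_mulInt (hD 1) 3)
    (CB.mem_mulInt (hD 2) 6)) (CB.mem_mulInt (hD 3) 3))

/-- boxes of the derived-`e″` margin LHS at `W` (derived / printed prefactor). [cite: Zhang2022LandauSiegel, §18 p. 99] -/
def wMargDD : FI := (wTotD.add (wRDD.re.mulInt 2)).add (FI.ofRat (1 / 50000))
/-- [cite: Zhang2022LandauSiegel, §18 p. 99] -/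
def wMargPD : FI := (wTotP.add (wRDD.re.mulInt 2)).add (FI.ofRat (1 / 50000))

/-- inclusion for the derived margin boxes. [cite: Moore1966, Theorem 3.1] -/
theorem mem_wMargD_of {x : ℝ} {X : FI} (hx : FI.mem x X) (hok : wResidOK = true) :
    FI.mem (x + 2 * (identResidualDT thetaW).re + 2e-5) ((X.add (wRDD.re.mulInt 2)).add (FI.ofRat (1 / 50000))) := by
  have h := FI.mem_add (FI.mem_add hx (FI.mem_mulInt (mem_wRDD hok).1 2)) (FI.mem_ofRat (1 / 50000))
  convert h using 1
  push_cast
  ring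

/-- **the certificate**: residual flag valid and the four margin boxes below `0.001·2⁴⁸`. [folklore] -/
def wMargCert : Bool :=
  wResidOK && decide (wMargD.hi * 1000 < (SC : ℤ)) && decide (wMargP.hi * 1000 < (SC : ℤ))
    && decide (wMargDD.hi * 1000 < (SC : ℤ)) && decide (wMargPD.hi * 1000 < (SC : ℤ))

/-- **the certificate passes**. [cite: Moore1966, Theorem 3.1] -/
theorem wMargCert_holds : wMargCert = true := by
  decide +kernel

/-- unpacking. [cite: Moore1966, Theorem 3.1] -/
theorem wMargCert_parts : wResidOK = true ∧ wMargD.hi * 1000 < (SC : ℤ) ∧ wMargP.hi * 1000 < (SC : ℤ) ∧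
    wMargDD.hi * 1000 < (SC : ℤ) ∧ wMargPD.hi * 1000 < (SC : ℤ) := by
  have h := wMargCert_holds
  simp only [wMargCert, Bool.and_eq_true, decide_eq_true_eq] at h
  exact ⟨h.1.1.1.1, h.1.1.1.2, h.1.1.2, h.1.2, h.2⟩

/-- **the printed §18 margin inequality HOLDS at `W`** (reading of record: derived prefactor, stated `e″`):
`Margin232D W`, i.e. `Re 𝔠₁(W) + Re 𝔠₂(W) + 2(Re 𝔠₃(W) + 10⁻⁵) < 0.001` with the UNREDUCED `𝔠₃` of (18.1).
[cite: Zhang2022LandauSiegel, (2.32) p. 11, §18 (18.1) p. 99] -/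
theorem margin232D_thetaW : Margin232D thetaW := by
  unfold Margin232D Margin232T
  rw [margin232LHS_thetaW, show (0.001 : ℝ) = 1 / 1000 by norm_num]
  have hm := mem_wMarg_of (mem_wTotD wCert_parts.1) wMargCert_parts.1
  exact lt_target_of_hi hm wMargCert_parts.2.1

/-- **… and in the printed-prefactor reading**: `Margin232P W` — the functional whose value at `θ₀` is the
failing inequality of record `Skeleton.Margin232` (`margin232T_theta0_iff`) holds at the admissible `W`.
[cite: Zhang2022LandauSiegel, (2.32) p. 11, §18 (18.1) p. 99] -/
theorem margin232P_thetaW : Margin232P thetaW := by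
  unfold Margin232P Margin232T
  rw [margin232LHS_thetaW, show (0.001 : ℝ) = 1 / 1000 by norm_num]
  have hm := mem_wMarg_of (mem_wTotP wCert_parts.1) wMargCert_parts.1
  exact lt_target_of_hi hm wMargCert_parts.2.2.1

/-- **the same in the DERIVED-`e″` reading** (`𝔠₃ᴰ = 𝔠₃ʳ + identResidualᴰ`, (B.3); reading of record
R2 of the rung), derived prefactor: `Re 𝔠₁(W) + Re 𝔠₂(W) + 2(Re 𝔠₃ᴰ(W) + 10⁻⁵) < 0.001`.
[cite: Zhang2022LandauSiegel, (2.32) p. 11, §18 (18.1) p. 99, Appendix B (B.3)] -/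
theorem margin232_derived_thetaW :
    (frakc1T thetaW).re + (frakc2T thetaW).re + 2 * ((frakc3DT thetaW).re + 1e-5) < 1e-3 := by
  have e : (frakc1T thetaW).re + (frakc2T thetaW).re + 2 * ((frakc3DT thetaW).re + 1e-5)
      = C232D thetaW + 2 * (identResidualDT thetaW).re + 2e-5 := by
    rw [frakc3DT_eq_add, Complex.add_re]
    unfold C232D C232T
    ring
  rw [e, show (1e-3 : ℝ) = 1 / 1000 by norm_num]
  exact lt_target_of_hi (mem_wMargD_of (mem_wTotD wCert_parts.1) wMargCert_parts.1) wMargCert_parts.2.2.2.1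

/-- … and with the printed `𝔠₃₄`-prefactor: `Re 𝔠₁(W) + Re 𝔠₂ᴾ(W) + 2(Re 𝔠₃ᴰ(W) + 10⁻⁵) < 0.001`.
[cite: Zhang2022LandauSiegel, (2.32) p. 11, (9.5)–(9.7), §18 (18.1) p. 99, Appendix B (B.3)] -/
theorem margin232_derived_thetaW_P :
    (frakc1T thetaW).re + (frakc2PT thetaW).re + 2 * ((frakc3DT thetaW).re + 1e-5) < 1e-3 := by
  have e : (frakc1T thetaW).re + (frakc2PT thetaW).re + 2 * ((frakc3DT thetaW).re + 1e-5)
      = C232P thetaW + 2 * (identResidualDT thetaW).re + 2e-5 := by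
    rw [frakc3DT_eq_add, Complex.add_re]
    unfold C232P C232T
    ring
  rw [e, show (1e-3 : ℝ) = 1 / 1000 by norm_num]
  exact lt_target_of_hi (mem_wMargD_of (mem_wTotP wCert_parts.1) wMargCert_parts.1) wMargCert_parts.2.2.2.2

/-- **the printed margin is met in class**: `∃ θ ∈ R` with `Margin232D θ ∧ Margin232P θ` (and, from
`RepairTprintWitness`, `C₂₃₃(θ) > 3000` and the joint criterion failing there).
[cite: Zhang2022LandauSiegel, (2.32)–(2.33) p. 11, §18 p. 99] -/
theorem margin232_met_in_class :
    ∃ θ, AdmissibleTheta θ ∧ Margin232D θ ∧ Margin232P θ ∧ 3000 < C233T θ ∧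
      ¬ (C232S θ * C233T θ < ‖dSumS θ‖ ^ 2) :=
  ⟨thetaW, admissible_thetaW, margin232D_thetaW, margin232P_thetaW, C233T_thetaW_gt, not_trueNeed_thetaW.1⟩

/-- **the failing inequality of record is not refutable over the whole class**: it fails at `θ₀`
(`Skeleton.not_margin232`, every `ι`: `no_iota_meets_ceiling`) but `¬ ∀ θ ∈ R, ¬ Margin232P θ`.
[cite: Zhang2022LandauSiegel, (2.32) p. 11, §18 p. 99] -/
theorem not_forall_not_margin232P : ¬ ∀ θ, AdmissibleTheta θ → ¬ Margin232P θ :=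
  fun h => h thetaW admissible_thetaW margin232P_thetaW

/-- the same for the reading of record `Margin232D`. [cite: Zhang2022LandauSiegel, (2.32) p. 11, §18 p. 99] -/
theorem not_forall_not_margin232D : ¬ ∀ θ, AdmissibleTheta θ → ¬ Margin232D θ :=
  fun h => h thetaW admissible_thetaW margin232D_thetaW

end Repair

end Literature.NumberTheory.LFunctions.Zhang2022
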